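import Mathlib
import HarnessLib
import Literature.Combinatorics.Additive.Kneser

/-!
# Grynkiewicz 2009, Theorem 4.1, CASE II (infinite `G`): the extension property (17) descends along a homomorphism injective on a sum–difference box

[cite: Grynkiewicz2009, §6 CASE II (proof of Thm 4.1, pp. 34–35)] [tag: critical-pair] [tag: inverse-theorem]

Topic `Literature/Combinatorics/Additive`.  Cell `mm-stpp` (D-0046), seat `mm-stpp-lit` (gen 25); the
port of D. J. Grynkiewicz, *A step beyond Kemperman's structure theorem*, Mathematika **55** (2009)
67–114.  CASE I (finite `G`) of Theorem 4.1 is the kernel theorem `Grynkiewicz2009.conclusion_of_finite`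
(`StepBeyondKempermanFiniteCase.lean`).  CASE II (print pp. 34–35) maps the pair `(A, B)` of a finitely
generated `G ≅ ℤ^l × T` into the finite group `(ℤ/pℤ)^l × T` by reducing the torsion-free coordinates
modulo a large prime — «`ϕ` is a Freiman isomorphism of `(A + T, B + T)` … and thus also of `(A, B)`.
Hence `|ϕ(A + B)| = |ϕ(A)| + |ϕ(B)| = |A| + |B|`» — applies the finite theorem there, and pulls the
alternatives back; for (17) the print's last sentence reads «Thus, since `ϕ` is a Freiman isomorphism for
`(A + T, B + T)`, since `H ≤ T`, and since the proof of Lemma 5.7 shows `α ∈ ϕ(A) + H` and `β ∈ ϕ(B) + H`,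
it follows that (17) holds for `(A, B)`».

THIS FILE is the first, purely combinatorial brick of that transfer, in a form that does not need the
location of `α, β` from Lemma 5.7: **`Grynkiewicz2009.seventeen_of_seventeen_image`** — let
`φ : G →+ G′` be a homomorphism of abelian groups, `0 ∈ A ∩ B`, `|A|, |B| ≥ 2`, `|A + B| = |A| + |B|`, and
suppose `φ` is injective on the box `(A + B − B) + (A + B − A)`.  If (17) holds for `(φ(A), φ(B))` in
`G′`, then (17) holds for `(A, B)` in `G`.  REASON (recorded as a deviation from the printed route, same
conclusion): if, say, `α′ ∉ φ(A)` and `β′ ∉ φ(B)` realise (17) for the image pair, the sumset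
`(φ(A) ∪ {α′}) + (φ(B) ∪ {β′})` exceeds `φ(A + B)` by exactly one element, so `α′ + φ(b) ∈ φ(A + B)` for
some `b ∈ B` (as `|B| ≥ 2`), i.e. `α′ = φ(α)` with `α ∈ A + B − B`, and likewise `β′ = φ(β)` with
`β ∈ A + B − A`; all of `(A ∪ {α}) + (B ∪ {β})` lies in the box, where `φ` is injective, so the
cardinalities agree and (17) holds for `(A, B)` with these `α, β`; the degenerate cases `α′ ∈ φ(A)` or
`β′ ∈ φ(B)` are similar with `α = 0` or `β = 0`.  Also recorded: `card_image_add_eq` (criticality is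
preserved under such `φ`), `vadd_eq_of_image_vadd_eq` (a translation invisible to `φ` is trivial) and
`addStab_image_eq_singleton` (aperiodicity of `S` passes to `φ(S)` when `φ` is injective on
`S + (S − S)`) — together exactly what is needed to APPLY `conclusion_of_finite` to `(φ(A), φ(B))`.

WHAT THIS FILE IS NOT: the rest of CASE II (the choice of `p`, the Freiman-isomorphism property of the
reduction map, the transfer of periodicity / quasi-periodicity for subgroups `H ≤ T`, of the decompositions
of Theorem 4.1 and of `d⊆`) is not here; no new definitions, no named facts.

## References
* D. J. Grynkiewicz, *A step beyond Kemperman's structure theorem*, Mathematika 55 (2009) 67–114,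
  doi:10.1112/S0025579300000966; §6 CASE II pp. 34–35 (held `paper:doi-10-1112-s0025579300000966`;
  arXiv:0710.1041 pp. 28–29, read 2026-08-29) [cite: Grynkiewicz2009, §6 CASE II].
-/

namespace Literature.Combinatorics.Additive

open Finset
open scoped Pointwise

namespace Grynkiewicz2009

variable {G G' : Type*} [AddCommGroup G] [AddCommGroup G'] [DecidableEq G] [DecidableEq G']

/-- The box `(A + B − B) + (A + B − A)` contains `A + B − B` (`0 ∈ A ∩ B`). [folklore] -/
private theorem subset_box_left {A B : Finset G} (h0A : (0 : G) ∈ A) (h0B : (0 : G) ∈ B) :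
    A + B - B ⊆ (A + B - B) + (A + B - A) := by
  intro x hx
  have h0 : (0 : G) ∈ A + B - A := mem_sub.2 ⟨0 + 0, add_mem_add h0A h0B, 0, h0A, by simp⟩
  have := add_mem_add hx h0
  rwa [add_zero] at this

/-- Likewise `A + B − A` lies in the box (`0 ∈ A ∩ B`). [folklore] -/
private theorem subset_box_right {A B : Finset G} (h0A : (0 : G) ∈ A) (h0B : (0 : G) ∈ B) :
    A + B - A ⊆ (A + B - B) + (A + B - A) := by
  intro x hx
  have h0 : (0 : G) ∈ A + B - B := mem_sub.2 ⟨0 + 0, add_mem_add h0A h0B, 0, h0B, by simp⟩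
  have := add_mem_add h0 hx
  rwa [zero_add] at this

/-- `A ⊆ A + B − B` when `0 ∈ B`. [folklore] -/
private theorem left_subset_sub {A B : Finset G} (h0B : (0 : G) ∈ B) : A ⊆ A + B - B := fun a ha =>
  mem_sub.2 ⟨a + 0, add_mem_add ha h0B, 0, h0B, by simp⟩

/-- `B ⊆ A + B − A` when `0 ∈ A`. [folklore] -/
private theorem right_subset_sub {A B : Finset G} (h0A : (0 : G) ∈ A) : B ⊆ A + B - A := fun b hb =>
  mem_sub.2 ⟨0 + b, add_mem_add h0A hb, 0, h0A, by simp⟩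

/-- `A + B ⊆ A + B − B` when `0 ∈ B`. [folklore] -/
private theorem add_subset_sub_left {A B : Finset G} (h0B : (0 : G) ∈ B) : A + B ⊆ A + B - B :=
  fun c hc => mem_sub.2 ⟨c, hc, 0, h0B, sub_zero c⟩

/-- `A + B ⊆ A + B − A` when `0 ∈ A`. [folklore] -/
private theorem add_subset_sub_right {A B : Finset G} (h0A : (0 : G) ∈ A) : A + B ⊆ A + B - A :=
  fun c hc => mem_sub.2 ⟨c, hc, 0, h0A, sub_zero c⟩

/-- **Criticality is preserved** by a homomorphism injective on `A + B` (⊆ the box): `|φ(A + B)| = |A + B|`,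
`|φ(A)| = |A|`, `|φ(B)| = |B|`, and `φ(A) + φ(B) = φ(A + B)` («Hence `|ϕ(A + B)| = |ϕ(A)| + |ϕ(B)| = |A| + |B|`»).
[cite: Grynkiewicz2009, §6 CASE II (p. 34)] -/
theorem card_image_add_eq (φ : G →+ G') {A B : Finset G} (h0A : (0 : G) ∈ A) (h0B : (0 : G) ∈ B)
    (hinj : Set.InjOn φ ↑((A + B - B) + (A + B - A))) :
    (A.image φ) + (B.image φ) = (A + B).image φ ∧ #((A + B).image φ) = #(A + B) ∧
      #(A.image φ) = #A ∧ #(B.image φ) = #B := by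
  have hK1 := subset_box_left h0A h0B
  refine ⟨(image_add φ).symm, card_image_of_injOn (hinj.mono ?_), card_image_of_injOn (hinj.mono ?_),
    card_image_of_injOn (hinj.mono ?_)⟩
  · exact coe_subset.2 ((add_subset_sub_left h0B).trans hK1)
  · exact coe_subset.2 ((left_subset_sub h0B).trans hK1)
  · exact coe_subset.2 ((right_subset_sub h0A).trans (subset_box_right h0A h0B))

/-- **(17) descends along a homomorphism injective on the box `(A + B − B) + (A + B − A)`** (see the
module docstring).  Hypotheses: `φ : G →+ G′`, `0 ∈ A ∩ B`, `|A|, |B| ≥ 2`, `|A + B| = |A| + |B|`, `φ`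
injective on the box; (17) for `(φ(A), φ(B))`.  Conclusion: (17) for `(A, B)`.
[cite: Grynkiewicz2009, §6 CASE II (pp. 34–35: «it follows that (17) holds for (A, B), completing the proof»)] -/
theorem seventeen_of_seventeen_image (φ : G →+ G') {A B : Finset G} (h0A : (0 : G) ∈ A)
    (h0B : (0 : G) ∈ B) (hA2 : 2 ≤ #A) (hB2 : 2 ≤ #B) (hAB : #(A + B) = #A + #B)
    (hinj : Set.InjOn φ ↑((A + B - B) + (A + B - A)))
    (h17 : ∃ α' β' : G', #(insert α' (A.image φ) + insert β' (B.image φ)) + 1 =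
      #(insert α' (A.image φ)) + #(insert β' (B.image φ))) :
    ∃ α β : G, #(insert α A + insert β B) + 1 = #(insert α A) + #(insert β B) := by
  classical
  obtain ⟨α', β', h17⟩ := h17
  set K : Finset G := (A + B - B) + (A + B - A) with hK
  obtain ⟨hsum, hcC, hcA, hcB⟩ := card_image_add_eq φ h0A h0B hinj
  have hK1 : A + B - B ⊆ K := subset_box_left h0A h0B
  have hK2 : A + B - A ⊆ K := subset_box_right h0A h0B
  have hAsub : A ⊆ A + B - B := left_subset_sub h0B
  have hBsub : B ⊆ A + B - A := right_subset_sub h0A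
  -- the key computation: for `α ∈ A + B − B`, `β ∈ A + B − A`, the extended pair lies in the box
  have key : ∀ {α β : G}, α ∈ A + B - B → β ∈ A + B - A →
      #(insert α A + insert β B) = #(insert (φ α) (A.image φ) + insert (φ β) (B.image φ)) ∧
      #(insert α A) = #(insert (φ α) (A.image φ)) ∧ #(insert β B) = #(insert (φ β) (B.image φ)) := by
    intro α β hα hβ
    have h1 : insert α A ⊆ A + B - B := insert_subset hα hAsub
    have h2 : insert β B ⊆ A + B - A := insert_subset hβ hBsub
    have h3 : insert α A + insert β B ⊆ K := add_subset_add (h1.trans Subset.rfl) h2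
    refine ⟨?_, ?_, ?_⟩
    · rw [← image_insert, ← image_insert, ← image_add,
        card_image_of_injOn (hinj.mono (coe_subset.2 h3))]
    · rw [← image_insert, card_image_of_injOn (hinj.mono (coe_subset.2 (h1.trans hK1)))]
    · rw [← image_insert, card_image_of_injOn (hinj.mono (coe_subset.2 (h2.trans hK2)))]
  -- preimages inside the box for points of `φ(A + B)`
  have pre : ∀ {x : G'}, x ∈ (A + B).image φ → ∃ c ∈ A + B, φ c = x := fun hx => by
    simpa only [mem_image] using hx
  by_cases hαA : α' ∈ A.image φ
  · rw [insert_eq_of_mem hαA] at h17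
    by_cases hβB : β' ∈ B.image φ
    · -- both degenerate: contradicts `|A + B| = |A| + |B|`
      rw [insert_eq_of_mem hβB, hsum, hcC, hcA, hcB] at h17
      omega
    · -- `α′ ∈ φ(A)`: take `α = 0`, `β` a preimage of `β′` in `A + B ⊆ A + B − A`
      have hcB' : #(insert β' (B.image φ)) = #B + 1 := by rw [card_insert_of_notMem hβB, hcB]
      have hsup : (A + B).image φ ⊆ A.image φ + insert β' (B.image φ) := by
        rw [← hsum]; exact add_subset_add_left (subset_insert _ _)
      have heq : A.image φ + insert β' (B.image φ) = (A + B).image φ :=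
        (eq_of_subset_of_card_le hsup (by rw [hcC, hAB]; omega)).symm
      have hβ'mem : β' ∈ (A + B).image φ := by
        rw [← heq]
        have := add_mem_add (mem_image_of_mem φ h0A) (mem_insert_self β' (B.image φ))
        rwa [map_zero, zero_add] at this
      obtain ⟨c, hc, hcβ⟩ := pre hβ'mem
      have hcK : c ∈ A + B - A := add_subset_sub_right h0A hc
      refine ⟨0, c, ?_⟩
      obtain ⟨k1, k2, k3⟩ := key (hAsub h0A) hcK
      have h0φ : (0 : G') ∈ A.image φ := by
        have := mem_image_of_mem φ h0A
        rwa [map_zero] at this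
      rw [k1, k2, k3, map_zero, hcβ, insert_eq_of_mem h0φ, heq, hcC, hcA, hcB', hAB]
      omega
  · by_cases hβB : β' ∈ B.image φ
    · -- `β′ ∈ φ(B)`: take `β = 0`, `α` a preimage of `α′` in `A + B ⊆ A + B − B`
      rw [insert_eq_of_mem hβB] at h17
      have hcA' : #(insert α' (A.image φ)) = #A + 1 := by rw [card_insert_of_notMem hαA, hcA]
      have hsup : (A + B).image φ ⊆ insert α' (A.image φ) + B.image φ := by
        rw [← hsum]; exact add_subset_add_right (subset_insert _ _)
      have heq : insert α' (A.image φ) + B.image φ = (A + B).image φ :=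
        (eq_of_subset_of_card_le hsup (by rw [hcC, hAB]; omega)).symm
      have hα'mem : α' ∈ (A + B).image φ := by
        rw [← heq]
        have := add_mem_add (mem_insert_self α' (A.image φ)) (mem_image_of_mem φ h0B)
        rwa [map_zero, add_zero] at this
      obtain ⟨c, hc, hcα⟩ := pre hα'mem
      have hcK : c ∈ A + B - B := add_subset_sub_left h0B hc
      refine ⟨c, 0, ?_⟩
      obtain ⟨k1, k2, k3⟩ := key hcK (hBsub h0B)
      have h0φ : (0 : G') ∈ B.image φ := by
        have := mem_image_of_mem φ h0B
        rwa [map_zero] at this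
      rw [k1, k2, k3, map_zero, hcα, insert_eq_of_mem h0φ, heq, hcC, hcA', hcB, hAB]
      omega
    · -- the generic case
      have hcA' : #(insert α' (A.image φ)) = #A + 1 := by rw [card_insert_of_notMem hαA, hcA]
      have hcB' : #(insert β' (B.image φ)) = #B + 1 := by rw [card_insert_of_notMem hβB, hcB]
      set S' := insert α' (A.image φ) + insert β' (B.image φ) with hS'
      have hcS' : #S' = #(A + B) + 1 := by rw [hcA', hcB'] at h17; omega
      have hsub : (A + B).image φ ⊆ S' := by
        rw [← hsum, hS']; exact add_subset_add (subset_insert _ _) (subset_insert _ _)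
      have hsd : #(S' \ (A + B).image φ) = 1 := by rw [card_sdiff_of_subset hsub, hcS', hcC]; omega
      -- some `α′ + φ(b)` and some `φ(a) + β′` land in `φ(A + B)`
      have hexα : ∃ b ∈ B, α' + φ b ∈ (A + B).image φ := by
        by_contra hno
        push Not at hno
        have hsubset : α' +ᵥ B.image φ ⊆ S' \ (A + B).image φ := by
          intro x hx
          obtain ⟨y, hy, rfl⟩ := mem_vadd_finset.1 hx
          obtain ⟨b, hb, rfl⟩ := mem_image.1 hy
          rw [mem_sdiff]
          refine ⟨?_, hno b hb⟩
          rw [hS', vadd_eq_add]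
          exact add_mem_add (mem_insert_self _ _) (mem_insert_of_mem (mem_image_of_mem φ hb))
        have := card_le_card hsubset
        rw [card_vadd_finset, hcB, hsd] at this
        omega
      have hexβ : ∃ a ∈ A, φ a + β' ∈ (A + B).image φ := by
        by_contra hno
        push Not at hno
        have hsubset : β' +ᵥ A.image φ ⊆ S' \ (A + B).image φ := by
          intro x hx
          obtain ⟨y, hy, rfl⟩ := mem_vadd_finset.1 hx
          obtain ⟨a, ha, rfl⟩ := mem_image.1 hy
          rw [mem_sdiff, vadd_eq_add, add_comm]
          refine ⟨?_, hno a ha⟩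
          rw [hS']
          exact add_mem_add (mem_insert_of_mem (mem_image_of_mem φ ha)) (mem_insert_self _ _)
        have := card_le_card hsubset
        rw [card_vadd_finset, hcA, hsd] at this
        omega
      obtain ⟨b, hb, hαb⟩ := hexα
      obtain ⟨a, ha, hβa⟩ := hexβ
      obtain ⟨c, hc, hcφ⟩ := pre hαb
      obtain ⟨c', hc', hc'φ⟩ := pre hβa
      -- `α = c − b ∈ A + B − B`, `β = c′ − a ∈ A + B − A`
      have hαK : c - b ∈ A + B - B := mem_sub.2 ⟨c, hc, b, hb, rfl⟩
      have hβK : c' - a ∈ A + B - A := mem_sub.2 ⟨c', hc', a, ha, rfl⟩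
      have hφα : φ (c - b) = α' := by rw [map_sub, hcφ, add_sub_cancel_right]
      have hφβ : φ (c' - a) = β' := by rw [map_sub, hc'φ, add_sub_cancel_left]
      refine ⟨c - b, c' - a, ?_⟩
      obtain ⟨k1, k2, k3⟩ := key hαK hβK
      rw [k1, k2, k3, hφα, hφβ, ← hS', hcS', hcA', hcB', hAB]
      omega

/-! ### Periods do not appear under `φ`: aperiodicity of `A + B` is preserved -/

omit [DecidableEq G] in
/-- Two subsets of a set on which `φ` is injective with the same image are equal. [folklore] -/
private theorem eq_of_image_eq_of_injOn (φ : G →+ G') {S₁ S₂ T : Finset G} (h₁ : S₁ ⊆ T) (h₂ : S₂ ⊆ T)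
    (hinj : Set.InjOn φ ↑T) (heq : S₁.image φ = S₂.image φ) : S₁ = S₂ := by
  have key : ∀ {X Y : Finset G}, X ⊆ T → Y ⊆ T → X.image φ = Y.image φ → X ⊆ Y := by
    intro X Y hX hY hXY x hx
    have hφx : φ x ∈ Y.image φ := by rw [← hXY]; exact mem_image_of_mem φ hx
    obtain ⟨y, hy, hyx⟩ := mem_image.1 hφx
    have := hinj (coe_subset.2 hY hy) (coe_subset.2 hX hx) hyx
    rw [← this]; exact hy
  exact Subset.antisymm (key h₁ h₂ heq) (key h₂ h₁ heq.symm)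

/-- The image of a translate is the translated image. [folklore] -/
private theorem image_vadd_eq (φ : G →+ G') (h : G) (S : Finset G) :
    (h +ᵥ S).image φ = φ h +ᵥ S.image φ := by
  ext y
  simp only [mem_image, mem_vadd_finset, vadd_eq_add]
  constructor
  · rintro ⟨x, ⟨s, hs, rfl⟩, rfl⟩
    exact ⟨φ s, ⟨s, hs, rfl⟩, by rw [map_add]⟩
  · rintro ⟨z, ⟨s, hs, rfl⟩, rfl⟩
    exact ⟨h + s, ⟨s, hs, rfl⟩, by rw [map_add]⟩

/-- **A translation invisible to `φ` is trivial**: if `S` and `h + S` lie in a set on which `φ` is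
injective and `φ(h) + φ(S) = φ(S)`, then `h + S = S` (used with `h ∈ S − S`: periods of `φ(S)` come from
periods of `S`). [cite: Grynkiewicz2009, §6 CASE II (p. 34: «Hence from the definition of `ϕ` it follows
that …» — the transfer of periodicity through the reduction map)] -/
theorem vadd_eq_of_image_vadd_eq (φ : G →+ G') {S T : Finset G} {h : G} (hST : S ⊆ T)
    (hhT : h +ᵥ S ⊆ T) (hinj : Set.InjOn φ ↑T) (hper : φ h +ᵥ S.image φ = S.image φ) :
    h +ᵥ S = S :=
  eq_of_image_eq_of_injOn φ hhT hST hinj (by rw [image_vadd_eq, hper])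

/-- **Aperiodicity is preserved**: if `S ≠ ∅` is aperiodic and `φ` is injective on `S + (S − S)`, then
`φ(S)` is aperiodic.  (A nonzero period of `φ(S)` is `φ(s₁) − φ(s₂) = φ(s₁ − s₂)` for some `s₁, s₂ ∈ S`;
then `s₁ − s₂` is a period of `S` by `vadd_eq_of_image_vadd_eq`, hence `0`.)  In CASE II this is the
observation that `ϕ(A + B)` inherits the aperiodicity of `A + B` (p. 34, the paragraph «If
`d⊆(ϕ(A + B), 𝒫_H) ≤ 2` … `H ≤ T` … a contradiction» in its simplest instance).
[cite: Grynkiewicz2009, §6 CASE II (p. 34)] -/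
theorem addStab_image_eq_singleton (φ : G →+ G') {S : Finset G} (hS : S.Nonempty)
    (hinj : Set.InjOn φ ↑(S + (S - S))) (hst : S.addStab = {0}) : (S.image φ).addStab = {0} := by
  have hSφ : (S.image φ).Nonempty := hS.image φ
  refine Subset.antisymm (fun g hg => ?_) (singleton_subset_iff.2 hSφ.zero_mem_addStab)
  rw [mem_singleton]
  have hgS : g +ᵥ S.image φ = S.image φ := (mem_addStab hSφ).1 hg
  -- `g = φ(s₁) − φ(s₂)`
  obtain ⟨s₂, hs₂⟩ := hS
  have hmem : g + φ s₂ ∈ S.image φ := by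
    rw [← hgS]; exact mem_vadd_finset.2 ⟨φ s₂, mem_image_of_mem φ hs₂, rfl⟩
  obtain ⟨s₁, hs₁, hs₁eq⟩ := mem_image.1 hmem
  set h : G := s₁ - s₂ with hh
  have hφh : φ h = g := by rw [hh, map_sub, hs₁eq, add_sub_cancel_right]
  -- `S`, `h + S ⊆ S + (S − S)`
  have hST : S ⊆ S + (S - S) := fun x hx => by
    have := add_mem_add hx (sub_mem_sub hx hx : x - x ∈ S - S)
    rwa [sub_self, add_zero] at this
  have hhT : h +ᵥ S ⊆ S + (S - S) := fun x hx => by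
    obtain ⟨y, hy, rfl⟩ := mem_vadd_finset.1 hx
    rw [vadd_eq_add, add_comm h y]
    exact add_mem_add hy (sub_mem_sub hs₁ hs₂)
  have hper : h +ᵥ S = S := vadd_eq_of_image_vadd_eq φ hST hhT hinj (by rw [hφh, hgS])
  have hh0 : h ∈ S.addStab := (mem_addStab ⟨s₂, hs₂⟩).2 hper
  rw [hst, mem_singleton] at hh0
  rw [← hφh, hh0, map_zero]

end Grynkiewicz2009

end Literature.Combinatorics.Additive
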